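/-
Origin: expansion seat `prover-pub-hodgecm-mc-binder-1-g15-0`, handover #R104 2026-08-20T19:17:44Z md5 f491eff37a3a (98 l.; NEW additive universe-free leaf; imports #R103 Model/HeckeThetaClasses only; install after #R103; drops with #R103; NAME LIST: HodgeCM.Model.HeckeThetaClasses.pull_mem_thetaClasses_of_apply_eq · HodgeCM.Model.HeckeThetaClasses.pull_mem_thetaClasses_of_rightTranslate · HodgeCM.Model.HeckeThetaClasses.pull_mem_thetaClasses_of_rightTranslateHom) (`HOME/mc/pub-hodgecm-mc-binder-1-g15/stage60/HodgeCM/Model/HeckeThetaClassesRational.lean`, md5 f491eff37a3a, 98 lines);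
landed by the second packager p2 gen 12 (p2-g12) in gate run 60 as `HodgeCM/Model/HeckeThetaClassesRational.lean` (verbatim).
-/
/-
Copyright (c) 2026 the pub-hodgecm formalisation cell (harness21).  New file, not vendored.
Origin: session prover-pub-hodgecm-mc-binder-1-g15-0 (unit pub-hodgecm-mc-binder-1-g15, BINDER PROVER gen 15 of lineage mc-binder-1;
content lane (J-Liu-Θ), HECKE-TOWER sub-leaf (T9b): the one-adelic-group / rationality-data forms of #R103), 2026-08-20.
Intended final place: `HodgeCM/Model/HeckeThetaClassesRational.lean` (NEW additive leaf, universe-free, datum-generic (p = 2); imports ONLY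
`HodgeCM.Model.HeckeThetaClasses` (#R103); nothing imports it; drops with #R103).
-/
import Summits.HodgeConjecture.HodgeCM.Model.HeckeThetaClasses

set_option autoImplicit false

/-!
# Theta classes along Hecke translates — one adelic group, rationality data

Corollaries of #R103 `pull_mem_thetaClasses_of_translate` in the shapes of the vendored N33b dictionary (`UnitaryBallClassMapTranslate`):
* `pull_mem_thetaClasses_of_apply_eq` — ONE adelic group `G_U`, hypothesis on adelic functions `F'(ιinf x) = F(ιinf (γ x))`;
* `pull_mem_thetaClasses_of_rightTranslate` — `γ` RATIONAL (`ιinf γ · k ∈ Γ_U`, `k` centralising `ιinf (U(2,1))`): it suffices that `Θ'` contain, for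
  each `F ∈ Θ`, a form `F'` with `F'(y) = F(y k⁻¹)` (vendored `WeightForms.comp_leftTranslate_eq_of_mem`);
* `pull_mem_thetaClasses_of_rightTranslateHom` — with `F' := ThetaKernelDatum.rightTranslateHom κ κ' η k⁻¹ hh hτ F` the vendored level-moving right
  translate, so that the remaining inputs are the rationality data `(k, hγk, hk)` of `γ = frameIso 𝔣 g` and the STABILITY `R(k⁻¹) Θ ⊆ Θ'`
  (for theta forms: vendored `rightTranslateHom_thetaForm`).
In all three the conclusion is `f^* ω ∈ thetaClasses ιinf (D'.classMapDatum …) Θ'` for the algebraic `f : X' ⟶ X` over the translate by `g`.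
KIND: kernel corollaries; nothing cited anew, nothing minted; 0 proof holes; expected `#print axioms` ⊆ {propext, Classical.choice, Quot.sound}.
-/

noncomputable section

open Matrix MulAction Function Set
open scoped TensorProduct
open CategoryTheory
open Literature.Geometry.ComplexHyperbolic
open Literature.Geometry.ComplexHyperbolic.BallModel (U21 Ball Jac x₀)
open Literature.NumberTheory.Automorphic
open Literature.NumberTheory.Automorphic.AutomorphyFactor
open Literature.AlgebraicGeometry.HodgeTheory
open Literature.AlgebraicGeometry.Motives (SchemeOver ComplexPoints AlgPoints bettiCohomology IsSmoothProjective)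

namespace HodgeCM.Model.HeckeThetaClasses

open Literature.AlgebraicGeometry.ShimuraVarieties UnitaryBallQuotientDatum

variable {X X' : SchemeOver ℂ} (D : UnitaryBallUniformisationDatum 2 X) (D' : UnitaryBallUniformisationDatum 2 X')
  (hHD : exists_isReal_hodgeModel) (𝔣 : D.SylvesterFrame) (𝔣' : D'.SylvesterFrame) (hI : hodgePQ_independent_of_hodgeModel)
variable {GU : Type*} [Group GU] {Kc Kc' : Type*} [Group Kc] [Group Kc']
variable {ΓU ΓU' : Subgroup GU} {κ : Kc →* GU} {κ' : Kc' →* GU}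
variable {τ : Representation ℂ Kc (Fin 2 → ℂ)} {τ' : Representation ℂ Kc' (Fin 2 → ℂ)}
variable (ιinf : U21 →* GU) {η₁ : stabilizer U21 x₀ →* Kc} {η₁' : stabilizer U21 x₀ →* Kc'}
variable (hΔ : WeightForms.IsLevelCorrected ΓU κ τ ιinf (D.ballImage 𝔣))
  (hη : WeightForms.IsWeightMatched κ τ ιinf (stabilizer U21 x₀).subtype (BallForms.isPullbackCocycle_cotangentCocycle.weightOf x₀) η₁)
  (hη' : WeightForms.IsWeightMatched κ' τ' ιinf (stabilizer U21 x₀).subtype (BallForms.isPullbackCocycle_cotangentCocycle.weightOf x₀) η₁')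

include hI in
/-- **One adelic group, hypothesis on adelic functions**: `F'(ιinf x) = F(ιinf (γ x))` for a partner `F' ∈ Θ'` of each `F ∈ Θ`.
[cite: Borel1997, §5.13–5.14] -/
theorem pull_mem_thetaClasses_of_apply_eq (hΔ' : WeightForms.IsLevelCorrected ΓU' κ' τ' ιinf (D'.ballImage 𝔣'))
    (f : X' ⟶ X) (g : D.realPoints) (hT : 𝔣'.t = 𝔣.t)
    (hf : ∀ v ∈ D'.cone, AlgPoints.map f (D'.unif v) = D.unif (((g : GL (Fin 3) ℂ) : Matrix (Fin 3) (Fin 3) ℂ) *ᵥ v))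
    (Θ : Submodule ℂ (weightForms ΓU κ τ)) (Θ' : Submodule ℂ (weightForms ΓU' κ' τ'))
    {ω : ℂ ⊗[ℚ] bettiCohomology X 1} (hω : ω ∈ WeightForms.thetaClasses ιinf (D.classMapDatum hHD 𝔣 hI ιinf hΔ hη) Θ)
    (hΘ : ∀ F ∈ Θ, ∃ F' ∈ Θ', ∀ x : U21, (F' : GU → Fin 2 → ℂ) (ιinf x) = (F : GU → Fin 2 → ℂ) (ιinf (D.frameIso 𝔣 g * x))) :
    (BettiUniverse.pull f 1).baseChange ℂ ω ∈ WeightForms.thetaClasses ιinf (D'.classMapDatum hHD 𝔣' hI ιinf hΔ' hη') Θ' :=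
  pull_mem_thetaClasses_of_translate D D' hHD 𝔣 𝔣' hI ιinf ιinf hΔ hη hΔ' hη' f g hT hf Θ Θ' hω fun F hF ↦ by
    obtain ⟨F', hF', h⟩ := hΘ F hF
    exact ⟨F', hF', funext fun x ↦ by rw [WeightForms.restrictHom_apply, WeightForms.restrictHom_apply, h x]⟩

include hI in
/-- **Rational translate, finite-adelic hypothesis**: for `γ = frameIso 𝔣 g` RATIONAL (`ιinf γ · k ∈ Γ_U`, `k` centralising `ιinf (U(2,1))`), it
suffices that `Θ'` contain for each `F ∈ Θ` a form `F'` with `F'(y) = F(y k⁻¹)`. [cite: Borel1997, §5.13–5.14] [folklore] -/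
theorem pull_mem_thetaClasses_of_rightTranslate (hΔ' : WeightForms.IsLevelCorrected ΓU' κ' τ' ιinf (D'.ballImage 𝔣'))
    (f : X' ⟶ X) (g : D.realPoints) (hT : 𝔣'.t = 𝔣.t)
    (hf : ∀ v ∈ D'.cone, AlgPoints.map f (D'.unif v) = D.unif (((g : GL (Fin 3) ℂ) : Matrix (Fin 3) (Fin 3) ℂ) *ᵥ v))
    (Θ : Submodule ℂ (weightForms ΓU κ τ)) (Θ' : Submodule ℂ (weightForms ΓU' κ' τ'))
    {k : GU} (hγk : ιinf (D.frameIso 𝔣 g) * k ∈ ΓU) (hk : ∀ x : U21, Commute k (ιinf x))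
    {ω : ℂ ⊗[ℚ] bettiCohomology X 1} (hω : ω ∈ WeightForms.thetaClasses ιinf (D.classMapDatum hHD 𝔣 hI ιinf hΔ hη) Θ)
    (hΘ : ∀ F ∈ Θ, ∃ F' ∈ Θ', ∀ y : GU, (F' : GU → Fin 2 → ℂ) y = (F : GU → Fin 2 → ℂ) (y * k⁻¹)) :
    (BettiUniverse.pull f 1).baseChange ℂ ω ∈ WeightForms.thetaClasses ιinf (D'.classMapDatum hHD 𝔣' hI ιinf hΔ' hη') Θ' :=
  pull_mem_thetaClasses_of_apply_eq D D' hHD 𝔣 𝔣' hI ιinf hΔ hη hη' hΔ' f g hT hf Θ Θ' hω fun F hF ↦ by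
    obtain ⟨F', hF', hk'⟩ := hΘ F hF
    exact ⟨F', hF', fun x ↦ by rw [hk', WeightForms.comp_leftTranslate_eq_of_mem ιinf F.2 hγk hk x]⟩

include hI in
/-- **Hecke-translate form**: with `F' := R(k⁻¹) F` the vendored level-moving right translate `ThetaKernelDatum.rightTranslateHom κ κ' η k⁻¹ hh hτ F`,
the remaining inputs are the rationality data of `γ = frameIso 𝔣 g` and the STABILITY `R(k⁻¹) Θ ⊆ Θ'`. [cite: Borel1997, §5.13–5.14] [folklore] -/
theorem pull_mem_thetaClasses_of_rightTranslateHom (Θ : Submodule ℂ (weightForms ΓU κ τ)) (Θ' : Submodule ℂ (weightForms ΓU κ' τ'))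
    {η : Kc' →* Kc} (hΔ' : WeightForms.IsLevelCorrected ΓU κ' τ' ιinf (D'.ballImage 𝔣'))
    (f : X' ⟶ X) (g : D.realPoints) (hT : 𝔣'.t = 𝔣.t)
    (hf : ∀ v ∈ D'.cone, AlgPoints.map f (D'.unif v) = D.unif (((g : GL (Fin 3) ℂ) : Matrix (Fin 3) (Fin 3) ℂ) *ᵥ v))
    {k : GU} (hγk : ιinf (D.frameIso 𝔣 g) * k ∈ ΓU) (hk : ∀ x : U21, Commute k (ιinf x))
    (hh : ∀ k' : Kc', κ' k' * k⁻¹ = k⁻¹ * κ (η k')) (hτ : ∀ k' : Kc', τ' k' = τ (η k'))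
    {ω : ℂ ⊗[ℚ] bettiCohomology X 1} (hω : ω ∈ WeightForms.thetaClasses ιinf (D.classMapDatum hHD 𝔣 hI ιinf hΔ hη) Θ)
    (hΘ : ∀ F ∈ Θ, Literature.NumberTheory.Weil1964.ThetaKernelDatum.rightTranslateHom κ κ' η k⁻¹ hh hτ F ∈ Θ') :
    (BettiUniverse.pull f 1).baseChange ℂ ω ∈ WeightForms.thetaClasses ιinf (D'.classMapDatum hHD 𝔣' hI ιinf hΔ' hη') Θ' :=
  pull_mem_thetaClasses_of_rightTranslate D D' hHD 𝔣 𝔣' hI ιinf hΔ hη hη' hΔ' f g hT hf Θ Θ' hγk hk hω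
    fun F hF ↦ ⟨_, hΘ F hF, fun _ ↦ rfl⟩

end HodgeCM.Model.HeckeThetaClasses

end
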